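import Summits.BirchSwinnertonDyer.BirchSwinnertonDyer.Theorems.PrintCf2RamifiedOffTYZMoverSquares
import HarnessLib

/-!
# Crux `PrintCf2.RamifiedOffTYZOfFacts` (stmt-BirchSwinnertonDyer-20509), line `offtyz-v7`, LEAD cycle 9 (cruxlead-20509 g8):
# THE MOD-2 MÖBIUS INVERSION OF TYZ's RECURSION FOR EVEN `n ≡ 6 (mod 8)` (step (E1) of the even mover programme)

THEOREMS ONLY (no `def`, no named fact, no `sorry`), `--supports stmt-BirchSwinnertonDyer-20509`.  The odd case is g7's
`MoverAssembly.moebius_recursion_mod_two` (p687456): for ODD square-free `n` every chain of length `≥ 2` of the recursion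
`P(e) = Z(e) − Σ_{d₀ ∈ recursionIndex e} ε 𝓛(e/d₀) P(d₀)` cancels mod 2 (fixed-point-free involution on pairs).  For EVEN `n = 2m ≡ 6 (mod 8)`
this FAILS (LEAD g5, `Lines/offtyz_v7_QForm.md` §8: "from an odd base `d ≡ 5` the even quotient block can only be applied at a partial product
`≡ 7 (8)`") and the correct closed form, found and checked by the LEAD g8's instrument (`even_moebius2.py`, 900 random `(n, ℓ, m)` with `k ≤ 6`
odd primes, 0 failures; crux workfile `Lines/offtyz_v7_SevenSector.md` §8), is:

  `μ(n) = m(n) + Σ_{d ∈ R(n)} ℓ(n/d) m(d) + Σ_{d ∈ R(n)} Σ_{d′ ∈ R(d), d′ ≡ 5 (8)} ℓ(n/d) ℓ(d/d′) m(d′)`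
  `        + Σ_{d ∈ R(n) even} Σ_{d′ ∈ R(d)} Σ_{e ∈ R(d′), e ≡ 5 (8)} ℓ(n/d) ℓ(d/d′) ℓ(d′/e) m(e)`   (`R = recursionIndex`)

whenever `μ(e) = m(e) + Σ_{d₀ ∈ R(e)} ℓ(e/d₀) μ(d₀)` for every divisor `e ≡ 5, 6, 7 (mod 8)` of `n` (`moebius_recursion_mod_two_even`): the
blocks `d ≡ 6` and `d ≡ 7` enter through ONE step (`ℓ(n/d)`), the blocks `d ≡ 5` through chains with exactly one even step `E ≡ 2 (8)`
followed by one odd step `A ≡ 3 (8)` (possibly preceded by one step `B ≡ 1 (8)`).  Mechanism (`sum_sum_recursionIndex_eq_zero_even`): the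
quotient-swapping involution `(d, d′) ↦ (d′·(n/d), d′)` of g7 still pairs off all two-step chains whose end is NOT `≡ 5 (mod 8)` (types
`(6,6)`, `(6,7) ↔ (7,7)`); induction on `n` and the odd lemma on the odd intermediate blocks do the rest.  §4 lifts it to the genus
points (`galPt_P_eq_add_moebius_even`, the even companion of g7's `galPt_P_eq_add_moebius`): for an automorphism `G` of `ℍ′_n` fixing `i`
under which every block's genus period `Z(d)` moves by `m(d)·τ(1)`, `G·P(n) − P(n)` is the displayed parity times `τ(1)` — the
`τ(1)`-coefficient the even mover assembly (squares `G = g·g`, next file) feeds into the even Galois-mover door (p677864).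
Pure combinatorics of divisors; BSD is not proved by any of this; no class is closed by this file.

References: [cite: TianYuanZhang2017, §3.1 (p0011 L67–L73: the recursion), proof of Thm. 3.5 (2) (p0020 L123–L165)]; crux notes
`Lines/offtyz_v7_QForm.md` §8, `Lines/offtyz_v7_SevenSector.md` §8.
-/

noncomputable section

open scoped Classical

open WeierstrassCurve WeierstrassCurve.Affine Finset Literature.NumberTheory.EllipticCurves
  Literature.NumberTheory.EllipticCurves.TianYuanZhang2017
  Literature.NumberTheory.EllipticCurves.TianYuanZhang2017.W2
  Summit.BirchSwinnertonDyer.Rank1Residual.P2.GenusPeriodTransferLayer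
  Summit.BirchSwinnertonDyer.Rank1Residual.P2.ThetaDescent

set_option autoImplicit false

namespace Summit.BirchSwinnertonDyer.PrintCf2.MoverAssembly

variable {n : ℕ}

/-! ## §1 Two-step chains not ending in a block `≡ 5 (mod 8)` cancel in pairs (even `n ≡ 6 (mod 8)`) -/

/-- Residues of the swapped middle block: for `n ≡ 6 (mod 8)`, `n = d·q₁`, `d = d′·q₂` with `d, d′ ≡ 5, 6, 7`, `q₁, q₂ ≡ 1, 2, 3 (mod 8)` and
`d′ ≢ 5 (mod 8)`, the product `d′·q₁` is again `≡ 5, 6, 7 (mod 8)`. [cite: TianYuanZhang2017, §3.1 (p0011 L67–L73)] -/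
theorem swap_residue_of_mod_eight_six {n d d' q₁ q₂ : ℕ} (h6 : n % 8 = 6) (hn : n = d * q₁) (hd : d = d' * q₂)
    (hd8 : d % 8 = 5 ∨ d % 8 = 6 ∨ d % 8 = 7) (hq₁ : q₁ % 8 = 1 ∨ q₁ % 8 = 2 ∨ q₁ % 8 = 3)
    (hd'8 : d' % 8 = 6 ∨ d' % 8 = 7) (hq₂ : q₂ % 8 = 1 ∨ q₂ % 8 = 2 ∨ q₂ % 8 = 3) :
    (d' * q₁) % 8 = 5 ∨ (d' * q₁) % 8 = 6 ∨ (d' * q₁) % 8 = 7 := by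
  have e1 : (d' * q₁) % 8 = ((d' % 8) * (q₁ % 8)) % 8 := Nat.mul_mod _ _ _
  have e2 : d % 8 = ((d' % 8) * (q₂ % 8)) % 8 := by rw [hd]; exact Nat.mul_mod _ _ _
  have e3 : n % 8 = ((d % 8) * (q₁ % 8)) % 8 := by rw [hn]; exact Nat.mul_mod _ _ _
  rw [e1]
  rw [e3, e2] at h6
  rw [e2] at hd8
  clear e1 e2 e3 hn hd
  generalize d' % 8 = A at h6 hd8 hd'8 ⊢
  generalize q₁ % 8 = B at h6 hd8 hq₁ ⊢
  generalize q₂ % 8 = C at h6 hd8 hq₂ ⊢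
  rcases hd'8 with rfl | rfl <;> rcases hq₁ with rfl | rfl | rfl <;> rcases hq₂ with rfl | rfl | rfl <;> omega

/-- **The two-step chains of the recursion that do not end in a block `≡ 5 (mod 8)` cancel in pairs (`n ≡ 6 (mod 8)` square-free).**
For `ℓ, μ : ℕ → ZMod 2` with `μ(e) = 0` whenever `e ≡ 5 (mod 8)`:
`Σ_{d ∈ recursionIndex n} Σ_{d′ ∈ recursionIndex d} ℓ(n/d)·ℓ(d/d′)·μ(d′) = 0` — the quotient swap `(d, d′) ↦ (d′·(n/d), d′)` is a
fixed-point-free involution of the pairs with `d′ ≡ 6, 7 (mod 8)` (types `(6,6) → (6,6)`, `(6,7) ↔ (7,7)`).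
[cite: TianYuanZhang2017, §3.1 (p0011 L67–L73)] -/
theorem sum_sum_recursionIndex_eq_zero_even (hn : Squarefree n) (h6 : n % 8 = 6) (ℓ μ : ℕ → ZMod 2)
    (hμ : ∀ e, e % 8 = 5 → μ e = 0) :
    ∑ d ∈ recursionIndex n, ∑ d' ∈ recursionIndex d, ℓ (n / d) * ℓ (d / d') * μ d' = 0 := by
  have hn0 : n ≠ 0 := hn.ne_zero
  -- pass to the sigma set and drop the pairs with `d′ ≡ 5` (their summand is `0`)
  have hσ : (∑ d ∈ recursionIndex n, ∑ d' ∈ recursionIndex d, ℓ (n / d) * ℓ (d / d') * μ d') =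
      ∑ x ∈ ((recursionIndex n).sigma (fun d => recursionIndex d)).filter (fun x => ¬ x.2 % 8 = 5),
        ℓ (n / x.1) * ℓ (x.1 / x.2) * μ x.2 := by
    rw [Finset.sum_filter, Finset.sum_sigma]
    refine Finset.sum_congr rfl fun d _ => Finset.sum_congr rfl fun d' _ => ?_
    dsimp only
    split_ifs with h
    · rw [hμ _ h, mul_zero]
    · rfl
  rw [hσ]
  -- unpack membership once
  have hmem : ∀ d d' : ℕ, (⟨d, d'⟩ : Σ _ : ℕ, ℕ) ∈ ((recursionIndex n).sigma (fun d => recursionIndex d)).filter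
      (fun x => ¬ x.2 % 8 = 5) →
      d ∣ n ∧ d' ∣ d ∧ (d % 8 = 5 ∨ d % 8 = 6 ∨ d % 8 = 7) ∧
        ((n / d) % 8 = 1 ∨ (n / d) % 8 = 2 ∨ (n / d) % 8 = 3) ∧ 1 < n / d ∧
        (d' % 8 = 6 ∨ d' % 8 = 7) ∧
        ((d / d') % 8 = 1 ∨ (d / d') % 8 = 2 ∨ (d / d') % 8 = 3) ∧ 1 < d / d' := by
    intro d d' hx
    simp only [Finset.mem_filter, Finset.mem_sigma] at hx
    obtain ⟨⟨hd, hd'⟩, h5⟩ := hx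
    rw [mem_recursionIndex_iff] at hd hd'
    have hd'8 : d' % 8 = 6 ∨ d' % 8 = 7 := by rcases hd'.2.1 with h | h | h <;> omega
    exact ⟨Nat.dvd_of_mem_divisors hd.1, Nat.dvd_of_mem_divisors hd'.1, hd.2.1, hd.2.2.1, hd.2.2.2,
      hd'8, hd'.2.2.1, hd'.2.2.2⟩
  refine Finset.sum_involution (fun x _ => ⟨x.2 * (n / x.1), x.2⟩) ?_ ?_ ?_ ?_
  · -- summands of a pair cancel
    rintro ⟨d, d'⟩ hx
    obtain ⟨hdd, hd'dd, -, -, -, -, -, -⟩ := hmem d d' hx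
    obtain ⟨e1, e2, -, -⟩ := div_pair_invol_aux hdd hd'dd hn0
    simp only [e1, e2]
    rw [← CharTwo.sub_eq_add, sub_eq_zero]
    ring
  · -- no fixed points
    rintro ⟨d, d'⟩ hx _
    obtain ⟨hdd, hd'dd, -, -, hgt, -, -, -⟩ := hmem d d' hx
    intro heq
    simp only [Sigma.mk.injEq, heq_eq_eq] at heq
    obtain ⟨h1, -⟩ := heq
    have hdvd : n / d ∣ d := ⟨d', by rw [mul_comm]; exact h1.symm⟩
    have hnd : d * (n / d) = n := Nat.mul_div_cancel' hdd
    have hcop : Nat.Coprime d (n / d) := Nat.coprime_of_squarefree_mul (hnd.symm ▸ hn)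
    have : n / d = 1 := Nat.eq_one_of_dvd_coprimes hcop.symm (dvd_refl _) hdvd
    omega
  · -- the image stays in the (filtered) index set
    rintro ⟨d, d'⟩ hx
    obtain ⟨hdd, hd'dd, hd8, hq8, hgt, hd'8, hq'8, hgt'⟩ := hmem d d' hx
    obtain ⟨e1, e2, hdvd, hne⟩ := div_pair_invol_aux hdd hd'dd hn0
    simp only [Finset.mem_filter, Finset.mem_sigma]
    rw [mem_recursionIndex_iff, mem_recursionIndex_iff, e1, e2]
    have hprod8 := swap_residue_of_mod_eight_six h6 (Nat.mul_div_cancel' hdd).symm (Nat.mul_div_cancel' hd'dd).symm hd8 hq8 hd'8 hq'8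
    have hd'8' : d' % 8 = 5 ∨ d' % 8 = 6 ∨ d' % 8 = 7 := by rcases hd'8 with h | h <;> omega
    have hd'pos : 0 < d' := by omega
    exact ⟨⟨⟨Nat.mem_divisors.mpr ⟨hdvd, hn0⟩, hprod8, hq'8, hgt'⟩,
      Nat.mem_divisors.mpr ⟨dvd_mul_right _ _, hne⟩, hd'8', hq8, hgt⟩, by rcases hd'8 with h | h <;> omega⟩
  · -- involutive
    rintro ⟨d, d'⟩ hx
    obtain ⟨hdd, hd'dd, -, -, -, -, -, -⟩ := hmem d d' hx
    obtain ⟨e1, -, -, -⟩ := div_pair_invol_aux hdd hd'dd hn0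
    simp only [e1, Nat.mul_div_cancel' hd'dd]

/-! ## §2 Odd intermediate blocks: the double sums beyond one step vanish -/

/-- For ODD square-free `d`, the two-step sum restricted to end blocks `≡ 5 (mod 8)` vanishes (g7's involution with the restricted weight).
[cite: TianYuanZhang2017, §3.1 (p0011 L67–L73)] -/
theorem sum_sum_filter_five_eq_zero_of_odd {d : ℕ} (hd : Squarefree d) (hodd : Odd d) (ℓ m : ℕ → ZMod 2) :
    ∑ d' ∈ recursionIndex d, ∑ e ∈ (recursionIndex d').filter (fun e => e % 8 = 5), ℓ (d / d') * ℓ (d' / e) * m e = 0 := by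
  have h := sum_sum_recursionIndex_eq_zero hd hodd ℓ (fun e => if e % 8 = 5 then m e else 0)
  rw [← h]
  refine Finset.sum_congr rfl fun d' _ => ?_
  rw [Finset.sum_filter]
  refine Finset.sum_congr rfl fun e _ => ?_
  split_ifs <;> simp

/-- For ODD `d`, `recursionIndex d` has no even element. [folklore] -/
theorem filter_even_recursionIndex_eq_empty_of_odd {d : ℕ} (hodd : Odd d) :
    (recursionIndex d).filter (fun d' => d' % 2 = 0) = ∅ := by
  rw [Finset.filter_eq_empty_iff]
  intro d' hd'
  rw [mem_recursionIndex_iff] at hd'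
  have h := (hodd.of_dvd_nat (Nat.dvd_of_mem_divisors hd'.1))
  rw [Nat.odd_iff] at h
  omega

/-! ## §3 The even Möbius inversion -/

/-- **Möbius inversion mod 2 of the recursion for even square-free `n ≡ 6 (mod 8)`** (see the module docstring for the formula and its meaning):
blocks `≡ 6, 7` enter through one step, blocks `≡ 5` through the chains `(E ≡ 2, A ≡ 3)` and `(B ≡ 1, E ≡ 2, A ≡ 3)`.
[cite: TianYuanZhang2017, §3.1 (p0011 L67–L73), proof of Thm. 3.5 (2) (p0020 L123–L165)] -/
theorem moebius_recursion_mod_two_even (hn : Squarefree n) (h6 : n % 8 = 6) (ℓ m μ : ℕ → ZMod 2)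
    (hrec : ∀ e, e ∣ n → (e % 8 = 5 ∨ e % 8 = 6 ∨ e % 8 = 7) → μ e = m e + ∑ d₀ ∈ recursionIndex e, ℓ (e / d₀) * μ d₀) :
    μ n = m n + ∑ d ∈ recursionIndex n, ℓ (n / d) * m d +
      ∑ d ∈ recursionIndex n, ∑ d' ∈ (recursionIndex d).filter (fun d' => d' % 8 = 5), ℓ (n / d) * ℓ (d / d') * m d' +
      ∑ d ∈ (recursionIndex n).filter (fun d => d % 2 = 0), ∑ d' ∈ recursionIndex d,
        ∑ e ∈ (recursionIndex d').filter (fun e => e % 8 = 5), ℓ (n / d) * ℓ (d / d') * ℓ (d' / e) * m e := by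
  induction n using Nat.strong_induction_on with
  | _ n ih =>
  have hn0 : n ≠ 0 := hn.ne_zero
  -- the level-`1` expansion of every block `d ∈ recursionIndex n`, odd or even, in ONE shape
  have hblock : ∀ d ∈ recursionIndex n, μ d = m d + ∑ d' ∈ recursionIndex d, ℓ (d / d') * m d' +
      ∑ d' ∈ recursionIndex d, ∑ e ∈ (recursionIndex d').filter (fun e => e % 8 = 5), ℓ (d / d') * ℓ (d' / e) * m e +
      ∑ d' ∈ (recursionIndex d).filter (fun d' => d' % 2 = 0), ∑ d'' ∈ recursionIndex d',
        ∑ e ∈ (recursionIndex d'').filter (fun e => e % 8 = 5), ℓ (d / d') * ℓ (d' / d'') * ℓ (d'' / e) * m e := by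
    intro d hd
    rw [mem_recursionIndex_iff] at hd
    obtain ⟨hdn, hd8, hq8, hgt⟩ := hd
    have hdd : d ∣ n := Nat.dvd_of_mem_divisors hdn
    have hdsq : Squarefree d := hn.squarefree_of_dvd hdd
    have hrecd : ∀ e, e ∣ d → (e % 8 = 5 ∨ e % 8 = 6 ∨ e % 8 = 7) → μ e = m e + ∑ d₀ ∈ recursionIndex e, ℓ (e / d₀) * μ d₀ :=
      fun e he he8 => hrec e (he.trans hdd) he8
    by_cases hpar : d % 2 = 0
    · -- even block: `d ≡ 6`, induction hypothesis
      have hd6 : d % 8 = 6 := by rcases hd8 with h | h | h <;> omega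
      have hdpos : 0 < d := Nat.pos_of_mem_divisors hdn
      have hlt : d < n := by
        have hnd : d * (n / d) = n := Nat.mul_div_cancel' hdd
        nlinarith
      exact ih d hlt hdsq hd6 hrecd
    · -- odd block: the odd lemma, and the extra sums vanish
      have hodd : Odd d := Nat.odd_iff.mpr (by omega)
      rw [moebius_recursion_mod_two hdsq hodd ℓ m μ (fun e he => by
          rcases he with rfl | he
          · exact hrecd e dvd_rfl hd8
          · rw [mem_recursionIndex_iff] at he
            exact hrecd e (Nat.dvd_of_mem_divisors he.1) he.2.1),
        sum_sum_filter_five_eq_zero_of_odd hdsq hodd ℓ m, filter_even_recursionIndex_eq_empty_of_odd hodd, Finset.sum_empty,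
        add_zero, add_zero]
  -- expand `μ n` one level and substitute
  rw [hrec n dvd_rfl (Or.inr (Or.inl h6))]
  have hstep : ∀ d ∈ recursionIndex n, ℓ (n / d) * μ d =
      ℓ (n / d) * m d + ∑ d' ∈ recursionIndex d, ℓ (n / d) * ℓ (d / d') * m d' +
      ∑ d' ∈ recursionIndex d, ∑ e ∈ (recursionIndex d').filter (fun e => e % 8 = 5), ℓ (n / d) * ℓ (d / d') * ℓ (d' / e) * m e +
      ∑ d' ∈ (recursionIndex d).filter (fun d' => d' % 2 = 0), ℓ (n / d) * ℓ (d / d') *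
        ∑ d'' ∈ recursionIndex d', ∑ e ∈ (recursionIndex d'').filter (fun e => e % 8 = 5), ℓ (d' / d'') * ℓ (d'' / e) * m e := by
    intro d hd
    rw [hblock d hd, mul_add, mul_add, mul_add, Finset.mul_sum, Finset.mul_sum, Finset.mul_sum]
    congr 1
    congr 1
    · congr 1
      · exact Finset.sum_congr rfl fun d' _ => by ring
    · refine Finset.sum_congr rfl fun d' _ => ?_
      rw [Finset.mul_sum]
      exact Finset.sum_congr rfl fun e _ => by ring
    · refine Finset.sum_congr rfl fun d' _ => ?_
      rw [Finset.mul_sum, Finset.mul_sum]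
      refine Finset.sum_congr rfl fun d'' _ => ?_
      rw [Finset.mul_sum, Finset.mul_sum]
      exact Finset.sum_congr rfl fun e _ => by ring
  rw [Finset.sum_congr rfl hstep, Finset.sum_add_distrib, Finset.sum_add_distrib, Finset.sum_add_distrib]
  -- (a) the two-step sums: keep the ends `≡ 5`, the rest cancels
  have ha : ∑ d ∈ recursionIndex n, ∑ d' ∈ recursionIndex d, ℓ (n / d) * ℓ (d / d') * m d' =
      ∑ d ∈ recursionIndex n, ∑ d' ∈ (recursionIndex d).filter (fun d' => d' % 8 = 5), ℓ (n / d) * ℓ (d / d') * m d' := by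
    have h0 := sum_sum_recursionIndex_eq_zero_even hn h6 ℓ (fun e => if e % 8 = 5 then 0 else m e)
      (fun e he => by rw [if_pos he])
    have hsplit : ∀ d ∈ recursionIndex n, ∑ d' ∈ recursionIndex d, ℓ (n / d) * ℓ (d / d') * m d' =
        ∑ d' ∈ (recursionIndex d).filter (fun d' => d' % 8 = 5), ℓ (n / d) * ℓ (d / d') * m d' +
        ∑ d' ∈ recursionIndex d, ℓ (n / d) * ℓ (d / d') * (if d' % 8 = 5 then 0 else m d') := by
      intro d _
      rw [Finset.sum_filter, ← Finset.sum_add_distrib]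
      refine Finset.sum_congr rfl fun d' _ => ?_
      split_ifs <;> simp
    rw [Finset.sum_congr rfl hsplit, Finset.sum_add_distrib, h0, add_zero]
  -- (b) the three-step sums over ODD `d` vanish, leaving the even ones
  have hb : ∑ d ∈ recursionIndex n, ∑ d' ∈ recursionIndex d, ∑ e ∈ (recursionIndex d').filter (fun e => e % 8 = 5),
        ℓ (n / d) * ℓ (d / d') * ℓ (d' / e) * m e =
      ∑ d ∈ (recursionIndex n).filter (fun d => d % 2 = 0), ∑ d' ∈ recursionIndex d,
        ∑ e ∈ (recursionIndex d').filter (fun e => e % 8 = 5), ℓ (n / d) * ℓ (d / d') * ℓ (d' / e) * m e := by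
    rw [Finset.sum_filter]
    refine Finset.sum_congr rfl fun d hd => ?_
    by_cases hpar : d % 2 = 0
    · rw [if_pos hpar]
    · rw [if_neg hpar]
      rw [mem_recursionIndex_iff] at hd
      have hdsq : Squarefree d := hn.squarefree_of_dvd (Nat.dvd_of_mem_divisors hd.1)
      have hodd : Odd d := Nat.odd_iff.mpr (by omega)
      have h0 := sum_sum_filter_five_eq_zero_of_odd hdsq hodd ℓ m
      have hmul : ∑ d' ∈ recursionIndex d, ∑ e ∈ (recursionIndex d').filter (fun e => e % 8 = 5),
          ℓ (n / d) * ℓ (d / d') * ℓ (d' / e) * m e =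
          ℓ (n / d) * ∑ d' ∈ recursionIndex d, ∑ e ∈ (recursionIndex d').filter (fun e => e % 8 = 5),
            ℓ (d / d') * ℓ (d' / e) * m e := by
        rw [Finset.mul_sum]
        refine Finset.sum_congr rfl fun d' _ => ?_
        rw [Finset.mul_sum]
        exact Finset.sum_congr rfl fun e _ => by ring
      rw [hmul, h0, mul_zero]
  -- (c) the four-step sums vanish: the first two steps are even-even pairs
  have hc : ∑ d ∈ recursionIndex n, ∑ d' ∈ (recursionIndex d).filter (fun d' => d' % 2 = 0), ℓ (n / d) * ℓ (d / d') *
        ∑ d'' ∈ recursionIndex d', ∑ e ∈ (recursionIndex d'').filter (fun e => e % 8 = 5), ℓ (d' / d'') * ℓ (d'' / e) * m e = 0 := by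
    have h0 := sum_sum_recursionIndex_eq_zero_even hn h6 ℓ
      (fun d' => if d' % 2 = 0 then ∑ d'' ∈ recursionIndex d', ∑ e ∈ (recursionIndex d'').filter (fun e => e % 8 = 5),
        ℓ (d' / d'') * ℓ (d'' / e) * m e else 0)
      (fun e he => by rw [if_neg (by omega)])
    rw [← h0]
    refine Finset.sum_congr rfl fun d _ => ?_
    rw [Finset.sum_filter]
    refine Finset.sum_congr rfl fun d' _ => ?_
    split_ifs <;> simp
  rw [ha, hb, hc, add_zero]
  ring

/-! ## §4 The genus point of an even `n ≡ 6 (mod 8)` under an automorphism fixing `i` -/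

section Galois

variable (D : GenusPointData n)

/-- **`G·P(n) = P(n) + (m(n) + Σ_{d ∈ R(n)} |𝓛(n/d)| m(d) + Σ_{d ∈ R(n)} Σ_{d′ ∈ R(d), d′ ≡ 5} |𝓛(n/d)||𝓛(d/d′)| m(d′)
+ Σ_{d ∈ R(n) even} Σ_{d′ ∈ R(d)} Σ_{e ∈ R(d′), e ≡ 5} |𝓛(n/d)||𝓛(d/d′)||𝓛(d′/e)| m(e))·τ(1)`** (`R = recursionIndex`) for EVEN square-free
`n ≡ 6 (mod 8)` and an automorphism `G` fixing `i` under which every block's genus PERIOD `Z(d)` moves by `m(d)·τ(1)` (the recursion of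
TYZ §3.1 displayed as `GenusPointData.recursion`) — the even companion of `galPt_P_eq_add_moebius` (p687456): the chains of the recursion
that survive mod 2 are exactly those of `moebius_recursion_mod_two_even`.
[cite: TianYuanZhang2017, §3.1 (p0011 L67–L73) and proof of Thm. 3.5 (2) / Lemma 3.21 (p0020 L27–L63, L123–L165)] -/
theorem galPt_P_eq_add_moebius_even (hn : Squarefree n) (h6 : n % 8 = 6)
    (hrec : D.recursion) (G : D.H ≃ₐ[ℚ] D.H) (hGi : G D.im = D.im) (m : ℕ → ℕ)
    (hm : ∀ d ∈ n.divisors, (d % 8 = 5 ∨ d % 8 = 6 ∨ d % 8 = 7) → D.galPt G (D.Z d) = D.Z d + m d • tauOne) :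
    D.galPt G (D.P n) = D.P n +
      (m n + ∑ d ∈ recursionIndex n, (D.scriptL (n / d)).natAbs * m d +
        ∑ d ∈ recursionIndex n, ∑ d' ∈ (recursionIndex d).filter (fun d' => d' % 8 = 5),
          (D.scriptL (n / d)).natAbs * (D.scriptL (d / d')).natAbs * m d' +
        ∑ d ∈ (recursionIndex n).filter (fun d => d % 2 = 0), ∑ d' ∈ recursionIndex d,
          ∑ e ∈ (recursionIndex d').filter (fun e => e % 8 = 5),
            (D.scriptL (n / d)).natAbs * (D.scriptL (d / d')).natAbs * (D.scriptL (d' / e)).natAbs * m e) • tauOne := by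
  have hn0 : n ≠ 0 := hn.ne_zero
  have h8 : n % 8 = 5 ∨ n % 8 = 6 ∨ n % 8 = 7 := Or.inr (Or.inl h6)
  have hnn : n ∈ n.divisors := Nat.mem_divisors_self n hn0
  -- every block's genus point moves by some multiple of `τ(1)`
  have hex := exists_galPt_P_eq_add_nsmul D hrec G hGi (fun d hd hd8 => ⟨m d, hm d hd hd8⟩)
  choose! μ hμ using hex
  -- the recursion for `μ` modulo 2
  have hμrec : ∀ e ∈ n.divisors, (e % 8 = 5 ∨ e % 8 = 6 ∨ e % 8 = 7) →
      ((μ e : ℕ) : ZMod 2) = (m e : ZMod 2) + ∑ d₀ ∈ recursionIndex e,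
        (((D.scriptL (e / d₀)).natAbs : ℕ) : ZMod 2) * ((μ d₀ : ℕ) : ZMod 2) := by
    intro e he he8
    have hlow : ∀ d₀ ∈ recursionIndex e, D.galPt G (D.P d₀) = D.P d₀ + μ d₀ • tauOne := by
      intro d₀ hd₀
      rw [mem_recursionIndex_iff] at hd₀
      obtain ⟨hd₀e, h8₀, -, -⟩ := hd₀
      exact hμ d₀ (Nat.divisors_subset_of_dvd hn0 (Nat.dvd_of_mem_divisors he) hd₀e) h8₀
    have hS := galPt_recursionSum_eq_add D G hGi e μ hlow
    have hPe := hμ e he he8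
    rw [hrec e he he8, map_sub, hm e he he8, hS] at hPe
    have key : (m e + ∑ d₀ ∈ recursionIndex e, (D.scriptL (e / d₀)).natAbs * μ d₀) • (tauOne : APoint D.H) =
        μ e • tauOne := by
      have e1 : ∀ (Z S : APoint D.H) (a b : ℕ),
          Z + a • (tauOne : APoint D.H) - (S + b • tauOne) = Z - S + (a + b) • tauOne := by
        intro Z S a b
        rw [add_smul, show Z + a • (tauOne : APoint D.H) - (S + b • tauOne) = Z - S + (a • tauOne + -(b • tauOne)) by abel,
          neg_nsmul_tauOne]
      rw [e1, ← hrec e he he8] at hPe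
      exact add_left_cancel hPe
    rw [nsmul_tauOne_eq_nsmul_tauOne_iff] at key
    rw [← key]
    push_cast
    rfl
  -- the even Möbius inversion
  have hmob := moebius_recursion_mod_two_even hn h6 (fun q => (((D.scriptL q).natAbs : ℕ) : ZMod 2))
    (fun d => ((m d : ℕ) : ZMod 2)) (fun d => ((μ d : ℕ) : ZMod 2))
    (fun e he he8 => hμrec e (Nat.mem_divisors.mpr ⟨he, hn0⟩) he8)
  rw [hμ n hnn h8]
  congr 1
  rw [nsmul_tauOne_eq_nsmul_tauOne_iff, hmob]
  push_cast
  rfl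

end Galois

end Summit.BirchSwinnertonDyer.PrintCf2.MoverAssembly

end
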